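import Summits.PneNP.PneNP.Theorems.SzkEntropyPeaWorstToAvgDualModeCompileAdviceElimExperiment
import Literature.Computability.Complexity.UniformDerandomizationSelectByTesting
import Literature.Computability.Complexity.UniformProbBlocks

/-!
# Route SzkEntropy, crux `PeaWorstToAvg` (stmt-PneNP-10777), line `dual-mode-compile`, stub `stub_adviceElim`:
# the counting core of labelled self-testing

Support file (2) for the stub `stub_adviceElim` (advice elimination by labelled self-testing), on top of
the experiment of `…AdviceElimExperiment.lean`.  Pure counting over coin strings (`cnt`, `uniformProb`):

* `uniformProb_add_le_of_select` — **the selection decomposition** (splitting the count over the test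
  string, the tree's `cnt_add_eq_sum_vector`): if on every GOOD test string `t` a candidate `σ t = c` is
  selected and the failure event on `t ++ z` is then an event `F c` of the fresh block `z` alone, the
  failure probability is at most `Pr[¬ GOOD] + Σ_c Pr[GOOD ∧ σ = c] · Pr[F c]`;
  `sum_uniformProb_select_le_one` — the selection weights sum to at most `1`;
* `uniformProb_out_ne_le` — the decomposition for the answer `out` of the uniform scheme;
* `rate`, `Good` — the true error rate of a candidate on a random labelled sample block, and the event
  "the true budget passes and every passing candidate has rate `< β`"; **`uniformProb_compl_good_le`** —
  it fails with probability `≤ (P + 2) · exp(−θ² N / 2)` once the threshold `τ` separates `rate c⋆ + θ`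
  from `β − θ` (the two-sided sampling estimate `BPPAmp.uniformProb_nbad_ge_le/_le_le`, a cylinder over
  each candidate's segment, and the union bound).

References: R. Impagliazzo, A. Wigderson, JCSS 63 (2001), Lemma 14 (selection by testing); W. Hoeffding,
JASA 58 (1963), Thm. 2; S. Arora, B. Barak, *Computational Complexity* (2009), §7.4.1, §A.2.
-/

noncomputable section

open _root_.Computability
open Literature.Computability.Complexity Literature.Computability.MetaComplexity
open Finset

namespace Summit.PneNP.PneNP.Cruxes.PeaWorstToAvg.DualModeCompile

set_option linter.dupNamespace false -- `Summit.PneNP.PneNP.…`: summit = sub-problem name (D-0017 single-conjunct layout)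

namespace AdviceElim

/-! ### Counts as filters -/

/-- A count as the cardinality of a filter over vectors (the definition, with any decidability
instance). [folklore] -/
theorem card_filter_eq_cnt (a : ℕ) (E : Set (List Bool)) [DecidablePred fun Y : List.Vector Bool a => Y.toList ∈ E] :
    (univ.filter fun Y : List.Vector Bool a => Y.toList ∈ E).card = cnt a E := by
  unfold cnt
  congr

/-! ### The selection decomposition -/

/-- **The selection decomposition.** On strings `t ++ z` (`|t| = a`, `|z| = k`), suppose that for every
GOOD `t` some candidate `σ t = c ∈ s` is selected and the event `E` then only depends on `z`, through
`F c`.  Then `Pr[E] ≤ Pr[¬ GOOD] + Σ_{c ∈ s} Pr[GOOD ∧ σ = c] · Pr[F c]` — test coins and output coins are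
independent. [ImpagliazzoWigderson2001, Lemma 14 (proof)] [AroraBarak2009, §7.4.1] -/
theorem uniformProb_add_le_of_select {a k : ℕ} {E G : Set (List Bool)} (s : Finset ℕ)
    (σ : List Bool → Option ℕ) (F : ℕ → Set (List Bool))
    (h : ∀ t : List Bool, t.length = a → t ∈ G →
      ∃ c ∈ s, σ t = some c ∧ ∀ z : List Bool, z.length = k → (t ++ z ∈ E ↔ z ∈ F c)) :
    uniformProb (a + k) E ≤
      uniformProb a Gᶜ + ∑ c ∈ s, uniformProb a {t | t ∈ G ∧ σ t = some c} * uniformProb k (F c) := by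
  classical
  -- pointwise bound on the fibres
  have hpt : ∀ Y : List.Vector Bool a, (cnt k {v | Y.toList ++ v ∈ E} : ℝ) ≤
      (if Y.toList ∈ Gᶜ then (2 : ℝ) ^ k else 0) +
        ∑ c ∈ s, (if Y.toList ∈ {t | t ∈ G ∧ σ t = some c} then (cnt k (F c) : ℝ) else 0) := by
    intro Y
    by_cases hY : Y.toList ∈ G
    · obtain ⟨c₀, hc₀, hσ, hiff⟩ := h Y.toList Y.toList_length hY
      have hE : cnt k {v | Y.toList ++ v ∈ E} = cnt k (F c₀) := cnt_congr fun z hz => hiff z hz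
      rw [hE, if_neg (fun h' => h' hY), zero_add, sum_eq_single c₀]
      · rw [if_pos ⟨hY, hσ⟩]
      · intro c _ hne
        rw [if_neg]
        rintro ⟨-, h2⟩
        rw [hσ] at h2
        exact hne (Option.some_injective _ h2).symm
      · intro hc₀'
        exact absurd hc₀ hc₀'
    · rw [if_pos (Set.mem_compl hY)]
      have h1 : (cnt k {v | Y.toList ++ v ∈ E} : ℝ) ≤ 2 ^ k := by exact_mod_cast cnt_le _ _
      have h2 : (0 : ℝ) ≤ ∑ c ∈ s, (if Y.toList ∈ {t | t ∈ G ∧ σ t = some c} then (cnt k (F c) : ℝ) else 0) :=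
        sum_nonneg fun c _ => by split_ifs <;> positivity
      linarith
  have hsum := sum_le_sum fun Y (_ : Y ∈ (univ : Finset (List.Vector Bool a))) => hpt Y
  rw [← Nat.cast_sum, ← cnt_add_eq_sum_vector, sum_add_distrib, sum_comm] at hsum
  -- evaluate the two sums
  have hG : ∑ Y : List.Vector Bool a, (if Y.toList ∈ Gᶜ then (2 : ℝ) ^ k else 0) = cnt a Gᶜ * 2 ^ k := by
    rw [sum_ite, sum_const_zero, add_zero, sum_const, nsmul_eq_mul, card_filter_eq_cnt]
  have hc : ∀ c ∈ s, ∑ Y : List.Vector Bool a,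
      (if Y.toList ∈ {t | t ∈ G ∧ σ t = some c} then (cnt k (F c) : ℝ) else 0) =
        cnt a {t | t ∈ G ∧ σ t = some c} * cnt k (F c) := by
    intro c _
    rw [sum_ite, sum_const_zero, add_zero, sum_const, nsmul_eq_mul, card_filter_eq_cnt]
  rw [hG, sum_congr rfl hc] at hsum
  -- divide by `2^(a+k)`
  rw [uniformProb_eq_cnt_div, pow_add, div_le_iff₀ (by positivity)]
  refine hsum.trans (le_of_eq ?_)
  rw [add_mul, sum_mul]
  congr 1
  · rw [uniformProb_eq_cnt_div]
    field_simp
  · refine sum_congr rfl fun c _ => ?_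
    rw [uniformProb_eq_cnt_div, uniformProb_eq_cnt_div]
    field_simp

/-- The selection weights `Pr[GOOD ∧ σ = c]` of distinct candidates are probabilities of disjoint events:
they sum to at most `1`. [folklore] -/
theorem sum_uniformProb_select_le_one (a : ℕ) (G : Set (List Bool)) (s : Finset ℕ) (σ : List Bool → Option ℕ) :
    ∑ c ∈ s, uniformProb a {t | t ∈ G ∧ σ t = some c} ≤ 1 := by
  classical
  simp only [uniformProb_eq_cnt_div]
  rw [← sum_div, div_le_one (by positivity), ← Nat.cast_sum]
  have hdisj : ∀ x ∈ s, ∀ y ∈ s, x ≠ y →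
      Disjoint (univ.filter fun r : List.Vector Bool a => r.toList ∈ {t | t ∈ G ∧ σ t = some x})
        (univ.filter fun r : List.Vector Bool a => r.toList ∈ {t | t ∈ G ∧ σ t = some y}) := by
    intro x _ y _ hxy
    rw [disjoint_filter]
    rintro r - ⟨-, h1⟩ ⟨-, h2⟩
    rw [h1] at h2
    exact hxy (Option.some_injective _ h2)
  have hsum : ∑ c ∈ s, cnt a {t | t ∈ G ∧ σ t = some c} =
      (s.biUnion fun c => univ.filter fun r : List.Vector Bool a => r.toList ∈ {t | t ∈ G ∧ σ t = some c}).card := by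
    rw [card_biUnion hdisj]
    exact sum_congr rfl fun c _ => (card_filter_eq_cnt a _).symm
  rw [hsum]
  have hle := card_le_univ (s.biUnion fun c => univ.filter fun r : List.Vector Bool a =>
    r.toList ∈ {t | t ∈ G ∧ σ t = some c})
  rw [card_vector, Fintype.card_bool] at hle
  exact_mod_cast hle

/-! ### The decomposition for the answer of the uniform scheme -/

variable {A : RandAlg (List Bool × ℕ × ℕ) Bool} {S : Bool → RandAlg ℕ (List Bool)}

/-- **Error of the uniform scheme at a fixed instance**: for every event `GOOD` of test strings on which a
candidate is selected, `Pr_R[out(y; R) ≠ lab] ≤ Pr_t[¬ GOOD] + Σ_{c ≤ P} Pr_t[GOOD ∧ sel = c] · e_c(y)`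
with `e_c(y) = Pr_z[maj_c(y; z) ≠ lab]` the error of candidate `c` on a fresh output block.
[ImpagliazzoWigderson2001, Lemma 14 (proof)] [BogdanovTrevisan2006, Def. 2.12] -/
theorem uniformProb_out_ne_le (pm : Params) (y : List Bool) (lab : Bool) {G : Set (List Bool)}
    (hG : ∀ t : List Bool, t.length = pm.testLen → t ∈ G → sel A S pm t ≠ none) :
    uniformProb pm.total {R | out A S pm y R ≠ lab} ≤
      uniformProb pm.testLen Gᶜ + ∑ c ∈ range (pm.P + 1),
        uniformProb pm.testLen {t | t ∈ G ∧ sel A S pm t = some c} *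
          uniformProb (pm.k * pm.P) {z | maj A (query pm.G pm.n y) c pm.k z ≠ lab} := by
  refine uniformProb_add_le_of_select (range (pm.P + 1)) (sel A S pm)
    (fun c => {z | maj A (query pm.G pm.n y) c pm.k z ≠ lab}) fun t ht htG => ?_
  obtain ⟨c, hc⟩ := Option.ne_none_iff_exists'.1 (hG t ht htG)
  refine ⟨c, mem_range.2 (Nat.lt_succ_of_le (sel_eq_some hc).1), hc, fun z hz => ?_⟩
  simp only [Set.mem_setOf_eq, out_append ht, hc]
  rw [List.take_of_length_le hz.le]

/-! ### The true error rates and the event `Good` -/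

variable (A S)

/-- **The true error rate of candidate `c`**: the probability, over a uniformly random labelled sample block,
that its majority vote on the padded query of the sampled instance differs from the label.
[ImpagliazzoWigderson2001, Lemma 14] -/
def rate (pm : Params) (c : ℕ) : ℝ :=
  uniformProb pm.L {blk | errBit A S pm c blk = true}

/-- **The event `Good`** of test strings: the true budget `c⋆` passes, and every passing candidate `c ≤ P`
has true error rate `< β`. [ImpagliazzoWigderson2001, Lemma 14 (proof)] -/
def Good (pm : Params) (cstar : ℕ) (β : ℝ) : Set (List Bool) :=
  {t | passes A S pm t cstar = true ∧ ∀ c ≤ pm.P, passes A S pm t c = true → rate A S pm c < β}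

variable {A S}

/-- On `Good` a candidate is selected (the true budget passes). [folklore] -/
theorem sel_ne_none_of_mem_good {pm : Params} {cstar : ℕ} {β : ℝ} (hcs : cstar ≤ pm.P) {t : List Bool}
    (ht : t ∈ Good A S pm cstar β) : sel A S pm t ≠ none :=
  sel_ne_none hcs ht.1

/-- On `Good` the selected candidate has rate `< β`. [folklore] -/
theorem rate_lt_of_mem_good {pm : Params} {cstar c : ℕ} {β : ℝ} {t : List Bool}
    (ht : t ∈ Good A S pm cstar β) (hc : sel A S pm t = some c) : rate A S pm c < β :=
  ht.2 c (sel_eq_some hc).1 (sel_eq_some hc).2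

/-- **A good candidate rarely fails**: if `N (rate c + θ) ≤ τ`, candidate `c` fails the test with probability
`≤ exp(−θ² N / 2)` (upper deviation of the empirical count, over the candidate's own segment).
[Hoeffding1963, Thm. 2] [ImpagliazzoWigderson2001, Lemma 14 (proof)] -/
theorem uniformProb_passes_false_le {pm : Params} {c : ℕ} (hc : c ≤ pm.P) (hN : 0 < pm.N) {θ : ℝ}
    (hθ : 0 ≤ θ) (h : (pm.N : ℝ) * (rate A S pm c + θ) ≤ pm.τ) :
    uniformProb pm.testLen {t | passes A S pm t c = false} ≤ Real.exp (-(θ ^ 2 * pm.N / 2)) := by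
  have hset : {t | passes A S pm t c = false} = {t | segment pm c t ∈
      {s | ¬ BPPAmp.nbad pm.N pm.L {blk | errBit A S pm c blk = true} s ≤ pm.τ}} := by
    ext t
    simp only [Set.mem_setOf_eq, passes, errCount_eq_nbad, decide_eq_false_iff_not]
  rw [hset, uniformProb_segment hc]
  refine (IWUniform.uniformProb_mono_of_imp fun s hs => ?_).trans
    (BPPAmp.uniformProb_nbad_ge_le (t := pm.N) (P := pm.L) {blk | errBit A S pm c blk = true} hN hθ)
  simp only [Set.mem_setOf_eq, not_le] at hs ⊢
  unfold rate at h
  have hs' : (pm.τ : ℝ) < BPPAmp.nbad pm.N pm.L {blk | errBit A S pm c blk = true} s := by exact_mod_cast hs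
  linarith

/-- **A bad candidate rarely passes**: if `τ ≤ N (rate c − θ)`, candidate `c` passes the test with probability
`≤ exp(−θ² N / 2)` (lower deviation). [Hoeffding1963, Thm. 2] [ImpagliazzoWigderson2001, Lemma 14 (proof)] -/
theorem uniformProb_passes_true_le {pm : Params} {c : ℕ} (hc : c ≤ pm.P) (hN : 0 < pm.N) {θ : ℝ}
    (hθ : 0 ≤ θ) (h : (pm.τ : ℝ) ≤ pm.N * (rate A S pm c - θ)) :
    uniformProb pm.testLen {t | passes A S pm t c = true} ≤ Real.exp (-(θ ^ 2 * pm.N / 2)) := by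
  have hset : {t | passes A S pm t c = true} = {t | segment pm c t ∈
      {s | BPPAmp.nbad pm.N pm.L {blk | errBit A S pm c blk = true} s ≤ pm.τ}} := by
    ext t
    simp only [Set.mem_setOf_eq, passes, errCount_eq_nbad, decide_eq_true_eq]
  rw [hset, uniformProb_segment hc]
  refine (IWUniform.uniformProb_mono_of_imp fun s hs => ?_).trans
    (BPPAmp.uniformProb_nbad_le_le (t := pm.N) (P := pm.L) {blk | errBit A S pm c blk = true} hN hθ)
  simp only [Set.mem_setOf_eq] at hs ⊢
  unfold rate at h
  have hs' : (BPPAmp.nbad pm.N pm.L {blk | errBit A S pm c blk = true} s : ℝ) ≤ pm.τ := by exact_mod_cast hs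
  linarith

/-- **`Good` fails rarely**: if the threshold separates the true budget (`N (rate c⋆ + θ) ≤ τ`) from the bad
candidates (`τ ≤ N (β − θ)`), then `Pr[¬ Good] ≤ (P + 2) · exp(−θ² N / 2)` — the true budget fails, or one
of the at most `P + 1` bad candidates passes (union bound). [ImpagliazzoWigderson2001, Lemma 14 (proof)]
[AroraBarak2009, §A.2 (union bound)] -/
theorem uniformProb_compl_good_le {pm : Params} {cstar : ℕ} {β θ : ℝ} (hcs : cstar ≤ pm.P) (hN : 0 < pm.N)
    (hθ : 0 ≤ θ) (h₁ : (pm.N : ℝ) * (rate A S pm cstar + θ) ≤ pm.τ) (h₂ : (pm.τ : ℝ) ≤ pm.N * (β - θ)) :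
    uniformProb pm.testLen (Good A S pm cstar β)ᶜ ≤ (pm.P + 2) * Real.exp (-(θ ^ 2 * pm.N / 2)) := by
  classical
  set η : ℝ := Real.exp (-(θ ^ 2 * pm.N / 2)) with hη
  set bad : Finset ℕ := (range (pm.P + 1)).filter fun c => β ≤ rate A S pm c with hbad
  have hcover : (Good A S pm cstar β)ᶜ ⊆ {t | passes A S pm t cstar = false} ∪
      ⋃ c ∈ bad, {t | passes A S pm t c = true} := by
    intro t ht
    rw [Set.mem_compl_iff, Good, Set.mem_setOf_eq, not_and_or] at ht
    rcases ht with ht | ht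
    · left
      simpa using ht
    · right
      simp only [not_forall, not_lt, exists_prop] at ht
      obtain ⟨c, hc, hpc, hrate⟩ := ht
      simp only [Set.mem_iUnion, Set.mem_setOf_eq, exists_prop, hbad, mem_filter, mem_range]
      exact ⟨c, ⟨Nat.lt_succ_of_le hc, hrate⟩, hpc⟩
  have hη0 : 0 ≤ η := (Real.exp_pos _).le
  calc uniformProb pm.testLen (Good A S pm cstar β)ᶜ
      ≤ uniformProb pm.testLen ({t | passes A S pm t cstar = false} ∪ ⋃ c ∈ bad, {t | passes A S pm t c = true}) :=
        IWUniform.uniformProb_mono_of_imp hcover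
    _ ≤ uniformProb pm.testLen {t | passes A S pm t cstar = false} +
          uniformProb pm.testLen (⋃ c ∈ bad, {t | passes A S pm t c = true}) := uniformProb_union_le _ _ _
    _ ≤ η + ∑ c ∈ bad, uniformProb pm.testLen {t | passes A S pm t c = true} :=
        add_le_add (uniformProb_passes_false_le hcs hN hθ h₁) (uniformProb_biUnion_le _ _ _)
    _ ≤ η + ∑ _c ∈ bad, η := by
        gcongr with c hc
        rw [hbad, mem_filter, mem_range] at hc
        refine uniformProb_passes_true_le (Nat.lt_succ_iff.1 hc.1) hN hθ (h₂.trans ?_)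
        have hNr : (0 : ℝ) ≤ pm.N := Nat.cast_nonneg _
        nlinarith [hc.2]
    _ = η + bad.card * η := by rw [sum_const, nsmul_eq_mul]
    _ ≤ η + (pm.P + 1) * η := by
        gcongr
        have := (card_filter_le (range (pm.P + 1)) fun c => β ≤ rate A S pm c)
        rw [card_range] at this
        exact_mod_cast this
    _ = (pm.P + 2) * η := by ring

end AdviceElim

/-- **Registered sub-goal of this file**: the event `Good` fails with probability `≤ (P + 2) exp(−θ² N / 2)`
once the threshold separates the true budget from the bad candidates (`AdviceElim.uniformProb_compl_good_le`).
[ImpagliazzoWigderson2001, Lemma 14; Hoeffding1963, Thm. 2] -/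
theorem adviceElim_good_fails_rarely (A : RandAlg (List Bool × ℕ × ℕ) Bool) (S : Bool → RandAlg ℕ (List Bool))
    {pm : AdviceElim.Params} {cstar : ℕ} {β θ : ℝ} (hcs : cstar ≤ pm.P) (hN : 0 < pm.N) (hθ : 0 ≤ θ)
    (h₁ : (pm.N : ℝ) * (AdviceElim.rate A S pm cstar + θ) ≤ pm.τ) (h₂ : (pm.τ : ℝ) ≤ pm.N * (β - θ)) :
    uniformProb pm.testLen (AdviceElim.Good A S pm cstar β)ᶜ ≤ (pm.P + 2) * Real.exp (-(θ ^ 2 * pm.N / 2)) :=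
  AdviceElim.uniformProb_compl_good_le hcs hN hθ h₁ h₂

end Summit.PneNP.PneNP.Cruxes.PeaWorstToAvg.DualModeCompile

end
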